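import Mathlib

/-!
# The machine's integer density test vs the pipeline's real thresholds — line «sfm-bl» (stmt-PneNP-20523)

FRONTIER F-N1c; nothing here bears on P vs NP.

The spot extraction of the machine (`SfmBlMachineSpots.dense`) tests `γsq · |W₁| · |W₂| < e · e` in `ℕ` with
`γsq = 3600 · (6000 · 2^60) = γ_sp²`; the parametric pipeline theorem `SfmBl.cutCertified_of_pipeline` states
density / sparsity with the real threshold `γ_sp · √(|W₁|·|W₂|)`, `γ_sp = 60 · √(6000 · 2^60)`.  This file is the
dictionary: `sfmBl_gammasp_mul_sqrt` (the real threshold is `√(γsq · a · b)`), `sfmBl_dense_iff_nat` (the two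
tests agree), `sfmBl_sparse_of_not_dense` (a failed test is the `hsp` inequality), and `sfmBl_dense_mono`
(density survives shrinking the sides with the leg count fixed — passing from the candidate pair to the images of
the spot's legs, clause `hdense`).  Mathlib only; definition-free.
-/

namespace Summit.PneNP.PneNP.Theorems.SfmBl

/-- `√(3600 · X) = 60 · √X`. -/
theorem sqrt_3600_mul (X : ℝ) : Real.sqrt (3600 * X) = 60 * Real.sqrt X := by
  rw [Real.sqrt_mul (by norm_num : (0 : ℝ) ≤ 3600), show (3600 : ℝ) = 60 ^ 2 by norm_num,
    Real.sqrt_sq (by norm_num : (0 : ℝ) ≤ 60)]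

/-- The pipeline's real threshold is the square root of the machine's integer one:
`60 · √(6000·2^60) · √(a·b) = √((3600·(6000·2^60)·a·b : ℕ))`. -/
theorem sfmBl_gammasp_mul_sqrt (a b : ℕ) :
    60 * Real.sqrt (6000 * 2 ^ 60) * Real.sqrt ((a : ℝ) * b)
      = Real.sqrt (((3600 * (6000 * 2 ^ 60) * a * b : ℕ) : ℝ)) := by
  rw [← sqrt_3600_mul, ← Real.sqrt_mul (by positivity)]
  congr 1
  push_cast
  ring

/-- THE TWO TESTS AGREE: `γ_sp · √(a·b) < e` (pipeline, reals) iff `γsq · a · b < e · e` (machine, naturals). -/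
theorem sfmBl_dense_iff_nat (a b e : ℕ) :
    60 * Real.sqrt (6000 * 2 ^ 60) * Real.sqrt ((a : ℝ) * b) < (e : ℝ)
      ↔ 3600 * (6000 * 2 ^ 60) * a * b < e * e := by
  rw [sfmBl_gammasp_mul_sqrt]
  rcases Nat.eq_zero_or_pos e with he | he
  · subst he
    simp only [Nat.cast_zero, not_lt.2 (Real.sqrt_nonneg _), mul_zero, Nat.not_lt_zero]
  · rw [Real.sqrt_lt' (by exact_mod_cast he), sq]
    exact_mod_cast Iff.rfl

/-- A FAILED density test is the sparsity inequality of clause `hsp`: `e ≤ γ_sp · √(a·b)`. -/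
theorem sfmBl_sparse_of_not_dense {a b e : ℕ} (h : ¬ 3600 * (6000 * 2 ^ 60) * a * b < e * e) :
    (e : ℝ) ≤ 60 * Real.sqrt (6000 * 2 ^ 60) * Real.sqrt ((a : ℝ) * b) := by
  rw [← sfmBl_dense_iff_nat] at h
  exact not_lt.1 h

/-- The same with the count given as a `Finset` cardinality bounded by `e` (the shape of `hsp`, whose left side
is `#{legs of the remainder from W₁ to W₂}`): if the test fails for `e` and the count is `≤ e`, the count is sparse. -/
theorem sfmBl_sparse_of_not_dense_le {a b e c : ℕ} (h : ¬ 3600 * (6000 * 2 ^ 60) * a * b < e * e)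
    (hc : c ≤ e) : (c : ℝ) ≤ 60 * Real.sqrt (6000 * 2 ^ 60) * Real.sqrt ((a : ℝ) * b) :=
  (Nat.cast_le.2 hc).trans (sfmBl_sparse_of_not_dense h)

/-- Density survives SHRINKING the sides with the leg count fixed (candidate pair `(a, b)` ⟶ images of the
spot's legs `(a', b')`, clause `hdense`). -/
theorem sfmBl_dense_mono {a a' b b' : ℕ} (ha : a' ≤ a) (hb : b' ≤ b) {e : ℝ}
    (h : 60 * Real.sqrt (6000 * 2 ^ 60) * Real.sqrt ((a : ℝ) * b) < e) :
    60 * Real.sqrt (6000 * 2 ^ 60) * Real.sqrt ((a' : ℝ) * b') < e := by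
  refine lt_of_le_of_lt ?_ h
  have hab : (a' : ℝ) * b' ≤ (a : ℝ) * b := by
    have := Nat.mul_le_mul ha hb
    exact_mod_cast this
  exact mul_le_mul_of_nonneg_left (Real.sqrt_le_sqrt hab) (by positivity)

/-- Pairs with an EMPTY side are trivially sparse (count `0`). -/
theorem sfmBl_sparse_of_side_empty {a b c : ℕ} (hc : c = 0) :
    (c : ℝ) ≤ 60 * Real.sqrt (6000 * 2 ^ 60) * Real.sqrt ((a : ℝ) * b) := by
  subst hc
  simp only [Nat.cast_zero]
  positivity

end Summit.PneNP.PneNP.Theorems.SfmBl
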